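import Literature.IUT.HodgeTheaters.PuncturedEllipticGeomOrigin
import Literature.AnabelianGeometry.AbsoluteAnabelian.FreeProfiniteCommutatorCusp
import Literature.GroupTheory.CocycleCentralExtension
import Mathlib.GroupTheory.GroupAction.ConjAct
import Mathlib.Tactic.Group
import HarnessLib

/-!
# [IUTchI] §1 p. 38 l. 22–24 — the law (L4) «`G_k` acts trivially on the cusp inertia groups modulo
# `Ker(Δ_X̲ ↠ Δ_X̲^{ab} ⊗ ℤ/l)`» DERIVED from (∗) via the mod-`l` Heisenberg quotient of `Δ_X ≅ F̂₂`

Mochizuki, *Inter-universal Teichmüller theory I*, kurims manuscript (May 2020), §1 p. 37 l. 20–24 (the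
assumption (∗): "the natural action of `G_k` on `Δ_X^{ab} ⊗ (ℤ/lℤ)` is trivial") and p. 38 l. 22–24 ("since [in light
of the assumption (∗)!] the natural [outer] action of `G_k` on `Δ_ε⁺ × Gal(X̲/C̲)` is trivial")
[cite: Mochizuki2012, IUTchI §1 pp.37-38] (D-0012 claim key; series status DISPUTED — nothing of the series is asserted
here); [AbsTopIII] Prop. 1.4 (i)(ii) p. 31 (cusp inertia `⟨[a,b]⟩⁻` and the cuspidally central quotient)
[cite: MochizukiAbsTopIII2015, Prop 1.4 p.31].

PROOF-ONLY file (cell abc-iut, seat abc-iut-L5-t1 gen 11 — the typer of record of `ModLCuspLaws`, p446054; HUB census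
`plan/L5/SUBDAG-IUTchI-Cor12.md` §V, GAP-LEDGER G-L5t1g11-4).  Of the four residual `Δ_ε`-level LAW clauses
(L2a)(L2c)(L3)(L4) displayed by the Cor. 1.2 closer candidate of record `…_of_geomOrigin_cor33i` (p496323), the clause
(L4) `ModLCuspLaws.inertia_central` — `∀ x, ∀ g ∈ Π_X̲, ∀ z ∈ I_x, g z g⁻¹ z⁻¹ ∈ Ker(Δ_X̲ ↠ Δ_X̲^{ab} ⊗ ℤ/l)` — is
the one print deduces from (∗) ("via the Weil pairing", `det E[l] = μ_l`).  THIS FILE PROVES IT from the datum's own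
field (∗) `PuncturedEllipticData.star`, the origin record (A)+(c′) (`GeomOrigin`: `Δ_X` free profinite on `a, b`;
every cusp inertia group a `Δ_X`-conjugate of `⟨[a,b]⟩⁻`) and ONE further origin-shaped input of the shape of the
EXISTING field `aug_decomp_twoε`:
  (r) `∀ x : D.Cusp, Function.Surjective (aug ∘ (D.decomp x).subtype)` — «every cusp of `X̲_K` is `K`-rational»
  (true for the data of [IUTchI] Def. 3.1: `K ⊇ F(E_F[l])`, the cusps of `X̲_K` are the `K`-rational points
  `E̲[l]/N`; print treats `ε⁰, ε′, ε″` as individual `K`-cusps, p. 37 l. 45 – p. 38 l. 24).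
THE GROUP THEORY (`inertia_central_of_star_freePro`; the Weil pairing, profinitely): let `φ : Δ_X → H(ℤ/l)` be
the continuous surjection onto the finite Heisenberg group with `a ↦ x`, `b ↦ y`, `[x, y] = ζ` CENTRAL of order
`l` (universal property of `F̂₂`, abc-iut-L4 `IsFreeProOn.exists_continuous_hom_pair`).  `φ` sends
`M := (⁅Δ_X,Δ_X⁆·Δ_X^l)⁻` into the centre (commutators and `l`-th powers of `H(ℤ/l)` lie in `Ker(H ↠ (ℤ/l)²)`,
which is central).  By (∗), conjugation `c_d` by any `d ∈ Π_X` moves each `p ∈ Δ_X` by an element of `M`, so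
`φ(c_d [p, q]) = [φ(m_p) φ(p), φ(m_q) φ(q)] = [φ p, φ q]`: `φ ∘ c_d = φ` on `⁅Δ_X,Δ_X⁆`, hence (closed equaliser,
discrete target) on `⁅Δ_X,Δ_X⁆⁻ ⊇ I_x`.  Now let `g ∈ Π_X̲`, `z ∈ I_x`; by (r) write `g = h d` with `d ∈ D_x`,
`h ∈ Δ_X̲`; then `z′ := d z d⁻¹ ∈ I_x` and `g z g⁻¹ z⁻¹ = [h, z′] · (z′ z⁻¹)` with `[h, z′] ∈ ⁅Δ_X̲, Δ_X̲⁆` and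
`φ(z′ z⁻¹) = 1`; since `I_x = ⟨w⟩⁻` (`w = k[a,b]k⁻¹`, `φ w = ζ` of order `l`) and `⟨w⟩⁻ = ⋃_{i<l} wⁱ ⟨w^l⟩⁻`, the
kernel of `φ` on `I_x` is `⟨w^l⟩⁻ ⊆ (Δ_X̲^l)⁻ ⊆ Ker(Δ_X̲ ↠ Δ_X̲^{ab} ⊗ ℤ/l)`.  ∎  — i.e. "`G_k` acts on `I_x ⊗ ℤ/l
≅ μ_l = ∧² E[l]` through `det = 1`", done inside `F̂₂`.
CONSEQUENCE for the census: the closer's LAW binders `hL4 hL4′` become THEOREMS of (∗)+(A)+(c′)+(r); the residual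
LAWS of [IUTchI] Cor. 1.2 at the genuine data are the three label clauses (L2a)(L2c)(L3) ×2 (sequel knit).

HONEST FRAMING: classical group theory; binders are assumption labels; nothing here bears on [IUTchIII] Cor. 3.12 or
asserts that abc is proved or refuted.  No `def`, no instance, no new `Prop` fact.
-/

noncomputable section

open Topology

namespace Literature.IUT.HodgeTheaters

namespace PuncturedEllipticData

open Literature.AnabelianGeometry.AbsoluteAnabelian Literature.GroupTheory

universe u

/-! ### §1. Generic plumbing: the finite Heisenberg test group; central translates; procyclic kernels -/

/-- **The finite Heisenberg group `H(ℤ/l)`** as the tree's twisted product `(ℤ/l)² ×_c ℤ/l` (`c(v, w) = v₁ w₂`):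
a finite group with a CENTRAL subgroup `Z = Ker(H ↠ (ℤ/l)²)` containing all commutators and all `l`-th powers, and
two elements `x, y` with `[x, y]` of order exactly `l` (cf. abc-iut-L4 `FreeProfiniteCommutatorCusp`).
[cite: MochizukiAbsTopIII2015, Prop 1.4 (ii) p.31] -/
private theorem exists_finite_heisenberg (l : ℕ) (hl : 0 < l) :
    ∃ (K : Type) (_ : Group K) (_ : Finite K) (Z : Subgroup K) (x y : K),
      Z ≤ Subgroup.center K ∧ (∀ p q : K, p * q * p⁻¹ * q⁻¹ ∈ Z) ∧ (∀ p : K, p ^ l ∈ Z) ∧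
        orderOf (x * y * x⁻¹ * y⁻¹) = l := by
  haveI : NeZero l := ⟨hl.ne'⟩
  let c : CentralCocycle (Multiplicative (ZMod l × ZMod l)) (Multiplicative (ZMod l)) :=
    { toFun := fun g h =>
        Multiplicative.ofAdd ((Multiplicative.toAdd g).1 * (Multiplicative.toAdd h).2)
      cocycle' := fun g h k => by
        rw [← ofAdd_add, ← ofAdd_add, toAdd_mul, toAdd_mul, Prod.fst_add, Prod.snd_add]
        congr 1
        ring
      map_one_one' := by
        rw [toAdd_one, Prod.fst_zero, zero_mul, ofAdd_zero] }
  let x : TwistedProduct c := ⟨Multiplicative.ofAdd (1, 0), 1⟩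
  let y : TwistedProduct c := ⟨Multiplicative.ofAdd (0, 1), 1⟩
  have hxy' : x * y = TwistedProduct.inl c (Multiplicative.ofAdd 1) * (y * x) := by
    refine TwistedProduct.ext ?_ ?_
    · change Multiplicative.ofAdd ((1 : ZMod l), (0 : ZMod l)) * Multiplicative.ofAdd (0, 1) =
        1 * (Multiplicative.ofAdd (0, 1) * Multiplicative.ofAdd (1, 0))
      rw [one_mul, mul_comm]
    · change (1 : Multiplicative (ZMod l)) * 1 * Multiplicative.ofAdd ((1 : ZMod l) * 1) =
        Multiplicative.ofAdd (1 : ZMod l) * (1 * 1 * Multiplicative.ofAdd ((0 : ZMod l) * 0)) *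
          c 1 (Multiplicative.ofAdd (0, 1) * Multiplicative.ofAdd (1, 0))
      rw [CentralCocycle.map_one_left, mul_one, mul_zero, ofAdd_zero, mul_one, one_mul, one_mul,
        mul_one, mul_one]
  have hxy : x * y * x⁻¹ * y⁻¹ = TwistedProduct.inl c (Multiplicative.ofAdd 1) := by
    simp only [hxy', mul_assoc, mul_inv_cancel, mul_one]
  refine ⟨TwistedProduct c, inferInstance, ?_, (TwistedProduct.fst c).ker, x, y, ?_, ?_, ?_, ?_⟩
  · exact Finite.of_equiv (Multiplicative (ZMod l × ZMod l) × Multiplicative (ZMod l))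
      ⟨fun p => ⟨p.1, p.2⟩, fun z => (z.g, z.a), fun _ => rfl, fun _ => rfl⟩
  · intro z hz
    rw [← TwistedProduct.range_inl_eq_ker_fst] at hz
    obtain ⟨a, rfl⟩ := hz
    exact TwistedProduct.inl_mem_center _
  · have hcomm : ∀ a b : Multiplicative (ZMod l × ZMod l), a * b * a⁻¹ * b⁻¹ = 1 := fun a b => by
      rw [mul_right_comm a b a⁻¹, mul_inv_cancel, one_mul, mul_inv_cancel]
    intro p q
    rw [MonoidHom.mem_ker, map_mul, map_mul, map_mul, map_inv, map_inv]
    exact hcomm _ _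
  · intro p
    rw [MonoidHom.mem_ker, map_pow, ← ofAdd_toAdd (TwistedProduct.fst c p), ← ofAdd_nsmul]
    have h0 : l • Multiplicative.toAdd (TwistedProduct.fst c p) = 0 := by
      ext <;> simp
    rw [h0, ofAdd_zero]
  · rw [hxy, orderOf_injective (TwistedProduct.inl c) TwistedProduct.inl_injective,
      orderOf_ofAdd_eq_addOrderOf, ZMod.addOrderOf_one]

/-- Commutators do not see CENTRAL translates: `[u₁ a, u₂ b] = [a, b]` for `u₁, u₂ ∈ Z(K)`. [folklore] -/
private theorem commutator_central_mul {K : Type*} [Group K] {u₁ u₂ : K} (h₁ : u₁ ∈ Subgroup.center K)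
    (h₂ : u₂ ∈ Subgroup.center K) (a b : K) :
    (u₁ * a) * (u₂ * b) * (u₁ * a)⁻¹ * (u₂ * b)⁻¹ = a * b * a⁻¹ * b⁻¹ := by
  have c₁i := Subgroup.mem_center_iff.mp (inv_mem h₁)
  have c₂i := Subgroup.mem_center_iff.mp (inv_mem h₂)
  have pull₁i : ∀ X Y : K, X * (u₁⁻¹ * Y) = u₁⁻¹ * (X * Y) := fun X Y => by
    rw [← mul_assoc, c₁i X, mul_assoc]
  have pull₂i : ∀ X Y : K, X * (u₂⁻¹ * Y) = u₂⁻¹ * (X * Y) := fun X Y => by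
    rw [← mul_assoc, c₂i X, mul_assoc]
  simp only [mul_inv_rev, mul_assoc]
  rw [pull₁i a⁻¹, pull₁i b, pull₁i u₂, pull₁i a, mul_inv_cancel_left, c₂i b⁻¹, pull₂i a⁻¹, pull₂i b,
    mul_inv_cancel_left]

/-- **Kernels on a procyclic closure**: if `φ` (continuous, to a discrete group, defined on a closed subgroup
`Δ ∋ w`) has `φ(w)` of order `l ≥ 1`, then an element of `⟨w⟩⁻` killed by `φ` lies in `⟨w^l⟩⁻` — because
`⟨w⟩⁻ = ⋃_{i<l} wⁱ · ⟨w^l⟩⁻` (a closed set containing `⟨w⟩`). [folklore] -/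
private theorem mem_closure_zpowers_pow_of_map_eq_one {P : Type*} [Group P] [TopologicalSpace P]
    [IsTopologicalGroup P] {K : Type*} [Group K] [TopologicalSpace K] [DiscreteTopology K]
    {Δ : Subgroup P} (hΔ : IsClosed (Δ : Set P)) {φ : Δ →* K} (hφ : Continuous φ)
    {w : P} (hw : w ∈ Δ) {l : ℕ} (hl : 0 < l) (hord : orderOf (φ ⟨w, hw⟩) = l)
    {u : P} (hu : u ∈ (Subgroup.zpowers w).topologicalClosure) (huΔ : u ∈ Δ)
    (hφu : φ ⟨u, huΔ⟩ = 1) : u ∈ (Subgroup.zpowers (w ^ l)).topologicalClosure := by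
  set V := (Subgroup.zpowers (w ^ l)).topologicalClosure with hV
  have hVc : IsClosed (V : Set P) := Subgroup.isClosed_topologicalClosure _
  have hVΔ : V ≤ Δ :=
    Subgroup.topologicalClosure_minimal _ (by rw [Subgroup.zpowers_le]; exact Δ.pow_mem hw l) hΔ
  -- `φ` kills `V`
  have hkc : IsClosed ((φ.ker.map Δ.subtype : Subgroup P) : Set P) := by
    rw [Subgroup.coe_map, Subgroup.coe_subtype]
    exact hΔ.isClosedEmbedding_subtypeVal.isClosedMap _
      (by rw [MonoidHom.coe_ker]; exact (isClosed_discrete _).preimage hφ)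
  have hVk : V ≤ φ.ker.map Δ.subtype := by
    refine Subgroup.topologicalClosure_minimal _ ?_ hkc
    rw [Subgroup.zpowers_le]
    refine ⟨⟨w, hw⟩ ^ l, ?_, rfl⟩
    change (⟨w, hw⟩ : Δ) ^ l ∈ φ.ker
    rw [MonoidHom.mem_ker, map_pow, ← hord, pow_orderOf_eq_one]
  have hVker : ∀ v (hv : v ∈ V), φ ⟨v, hVΔ hv⟩ = 1 := by
    intro v hv
    obtain ⟨v', hv', hvv'⟩ := hVk hv
    have h : (⟨v, hVΔ hv⟩ : Δ) = v' := Subtype.ext hvv'.symm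
    rw [h]
    exact hv'
  -- the closed set `⋃_{i<l} wⁱ V ⊇ ⟨w⟩`
  set C : Set P := ⋃ i ∈ Finset.range l, (fun p => w ^ i * p) '' (V : Set P) with hC
  have hCc : IsClosed C := by
    refine Set.Finite.isClosed_biUnion (Finset.range l).finite_toSet fun i _ => ?_
    rw [← Homeomorph.coe_mulLeft]
    exact (Homeomorph.mulLeft (w ^ i)).isClosed_image.mpr hVc
  have hl0 : (0 : ℤ) < l := by exact_mod_cast hl
  have hsub : ((Subgroup.zpowers w : Subgroup P) : Set P) ⊆ C := by
    intro p hp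
    obtain ⟨k, rfl⟩ := Subgroup.mem_zpowers_iff.mp hp
    have hi0 : (0 : ℤ) ≤ k % l := Int.emod_nonneg _ hl0.ne'
    have hil : k % l < l := Int.emod_lt_of_pos _ hl0
    have hii : ((k % l).toNat : ℤ) = k % l := Int.toNat_of_nonneg hi0
    have hilt : (k % l).toNat < l := by omega
    refine Set.mem_iUnion₂.mpr ⟨(k % l).toNat, Finset.mem_range.mpr hilt, (w ^ l) ^ (k / l), ?_, ?_⟩
    · exact Subgroup.le_topologicalClosure _ (Subgroup.mem_zpowers_iff.mpr ⟨k / l, rfl⟩)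
    · change w ^ (k % l).toNat * (w ^ l) ^ (k / l) = w ^ k
      rw [← zpow_natCast w (k % l).toNat, hii, ← zpow_natCast w l, ← zpow_mul, ← zpow_add,
        Int.emod_add_mul_ediv]
  have huC : u ∈ C := by
    have hcl : closure ((Subgroup.zpowers w : Subgroup P) : Set P) ⊆ C := hCc.closure_subset_iff.mpr hsub
    apply hcl
    rw [← Subgroup.topologicalClosure_coe]
    exact hu
  rw [hC, Set.mem_iUnion₂] at huC
  obtain ⟨i, hi, v, hv, hvu'⟩ := huC
  have hvu : w ^ i * v = u := hvu'
  have hvΔ : v ∈ Δ := hVΔ hv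
  have hφv : φ ⟨v, hvΔ⟩ = 1 := hVker v hv
  have hwi : (⟨u, huΔ⟩ : Δ) = ⟨w, hw⟩ ^ i * ⟨v, hvΔ⟩ := Subtype.ext (by simp [← hvu])
  have h1 : φ ⟨w, hw⟩ ^ i = 1 := by
    have h := hφu
    rwa [hwi, map_mul, map_pow, hφv, mul_one] at h
  have hi0' : i = 0 := by
    have hdvd : l ∣ i := by rw [← hord]; exact orderOf_dvd_of_pow_eq_one h1
    exact Nat.eq_zero_of_dvd_of_lt hdvd (Finset.mem_range.mp hi)
  rw [← hvu, hi0', pow_zero, one_mul]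
  exact hv

/-! ### §2. (L4) from (∗) + (A) + (c′) + cusp rationality -/

variable (D : PuncturedEllipticData.{u})

/-- **[IUTchI] §1 (L4) from (∗)** — "[in light of the assumption (∗)!] the natural [outer] action of `G_k` on
`Δ_ε⁺ …` is trivial" (p. 38 l. 22–24) at the level of the cusp inertia groups: if `Δ_X = Π_X ∩ Δ_C` is free
profinite on `a, b` (A), every cusp inertia group is a `Δ_X`-conjugate of `⟨[a,b]⟩⁻` (c′), and every cusp of `X̲`
is `k`-rational (its decomposition group surjects onto `G_k`), then the field (∗) `star` forces `Π_X̲` to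
centralise every `I_x` modulo `Ker(Δ_X̲ ↠ Δ_X̲^{ab} ⊗ ℤ/l)` — EXACTLY the clause `ModLCuspLaws.inertia_central`
(the binders `hL4`, `hL4′` of `…_of_originLaws_modLFields` / `…_of_geomOrigin_cor33i`).  Proof: the mod-`l`
Heisenberg quotient of `F̂₂` (module docstring). ([IUTchI] §1 p.38) [claim: Mochizuki2012, status: disputed] -/
theorem inertia_central_of_star_freePro {gens : Fin 2 → ↥(D.PiX ⊓ D.DeltaC)}
    (hfree : IsFreeProOn ↥(D.PiX ⊓ D.DeltaC) Set.univ gens)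
    (hcusp : ∀ x : D.Cusp, ∃ g ∈ D.PiX ⊓ D.DeltaC,
      D.inertia x = (Subgroup.zpowers (g * ((gens 0 : D.PiC) * (gens 1 : D.PiC) *
        (gens 0 : D.PiC)⁻¹ * (gens 1 : D.PiC)⁻¹) * g⁻¹)).topologicalClosure)
    (hrat : ∀ x : D.Cusp, Function.Surjective (D.E.aug.toMonoidHom.comp (D.decomp x).subtype)) :
    ∀ x : D.Cusp, ∀ g ∈ D.PiXbar, ∀ z ∈ D.inertia x, g * z * g⁻¹ * z⁻¹ ∈ D.modLKer := by
  classical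
  intro x g hg z hz
  -- `Δ := Δ_X = Π_X ∩ Δ_C`, closed and normal in `Π_C`
  have hΔc : IsClosed ((D.PiX ⊓ D.DeltaC : Subgroup D.PiC) : Set D.PiC) := D.isClosed_piX_inf_deltaC
  haveI hΔn : (D.PiX ⊓ D.DeltaC).Normal := by
    haveI := D.piX_normal
    haveI : D.DeltaC.Normal := D.E.normal_geom
    exact Subgroup.normal_inf_normal D.PiX D.DeltaC
  have hl : 0 < D.l := by have := D.five_le; omega
  -- the Heisenberg quotient `φ : Δ_X → H(ℤ/l)`
  obtain ⟨K, _, _, Z, xK, yK, hZc, hZcomm, hZpow, hord⟩ := exists_finite_heisenberg D.l hl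
  letI : TopologicalSpace K := ⊥
  haveI : DiscreteTopology K := ⟨rfl⟩
  obtain ⟨φ, hφc, hφa, hφb⟩ := hfree.exists_continuous_hom_pair (fun p _ => Set.mem_univ p)
    (show (0 : Fin 2) ≠ 1 from by decide) K xK yK
  -- `φ(M) ⊆ Z` for `M = (⁅Δ,Δ⁆ · Δ^l)⁻`, the subgroup of (∗)
  set M : Subgroup D.PiC := (⁅D.PiX ⊓ D.DeltaC, D.PiX ⊓ D.DeltaC⁆ ⊔
    Subgroup.closure ((fun y : D.PiC => y ^ D.l) '' ((D.PiX ⊓ D.DeltaC : Subgroup D.PiC) : Set D.PiC))).topologicalClosure with hMdef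
  have hemb : Topology.IsClosedEmbedding ((↑) : ↥(D.PiX ⊓ D.DeltaC) → D.PiC) := hΔc.isClosedEmbedding_subtypeVal
  have hZZc : IsClosed (((Z.comap φ).map (D.PiX ⊓ D.DeltaC).subtype : Subgroup D.PiC) : Set D.PiC) := by
    rw [Subgroup.coe_map, Subgroup.coe_subtype]
    exact hemb.isClosedMap _ (by rw [Subgroup.coe_comap]; exact (isClosed_discrete _).preimage hφc)
  have hMZ : M ≤ (Z.comap φ).map (D.PiX ⊓ D.DeltaC).subtype := by
    refine Subgroup.topologicalClosure_minimal _ (sup_le ?_ ?_) hZZc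
    · rw [Subgroup.commutator_le]
      intro p hp q hq
      refine ⟨⟨p, hp⟩ * ⟨q, hq⟩ * ⟨p, hp⟩⁻¹ * ⟨q, hq⟩⁻¹, ?_, rfl⟩
      change φ (⟨p, hp⟩ * ⟨q, hq⟩ * ⟨p, hp⟩⁻¹ * ⟨q, hq⟩⁻¹) ∈ Z
      rw [map_mul, map_mul, map_mul, map_inv, map_inv]
      exact hZcomm _ _
    · rw [Subgroup.closure_le]
      rintro _ ⟨y, hy, rfl⟩
      refine ⟨⟨y, hy⟩ ^ D.l, ?_, rfl⟩
      change φ (⟨y, hy⟩ ^ D.l) ∈ Z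
      rw [map_pow]
      exact hZpow _
  -- (∗): conjugation by `d ∈ Π_X` moves `p ∈ Δ` by an element of `M`, whose `φ`-value is central
  have hstar : ∀ d ∈ D.PiX, ∀ p (hp : p ∈ D.PiX ⊓ D.DeltaC),
      ∃ m : ↥(D.PiX ⊓ D.DeltaC), φ m ∈ Subgroup.center K ∧ d * p * d⁻¹ = (m : D.PiC) * p := by
    intro d hd p hp
    have h := D.star d hd p hp
    obtain ⟨m, hm, hmeq⟩ := hMZ h
    refine ⟨m, hZc hm, ?_⟩
    rw [Subgroup.coe_subtype] at hmeq
    rw [hmeq, inv_mul_cancel_right]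
  -- hence `φ ∘ c_d = φ` on `⁅Δ,Δ⁆⁻`
  have hconj_mem : ∀ d ∈ D.PiX, ∀ p ∈ D.PiX ⊓ D.DeltaC, d * p * d⁻¹ ∈ D.PiX ⊓ D.DeltaC := fun d _ p hp => hΔn.conj_mem p hp d
  have hfix : ∀ d (hd : d ∈ D.PiX) u
      (hu : u ∈ (⁅D.PiX ⊓ D.DeltaC, D.PiX ⊓ D.DeltaC⁆).topologicalClosure) (huΔ : u ∈ D.PiX ⊓ D.DeltaC),
      φ ⟨d * u * d⁻¹, hconj_mem d hd u huΔ⟩ = φ ⟨u, huΔ⟩ := by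
    intro d hd u hu huΔ
    -- the closed equaliser `T` of `φ ∘ c_d` and `φ` in `Δ`
    set cd : ↥(D.PiX ⊓ D.DeltaC) →* ↥(D.PiX ⊓ D.DeltaC) :=
      (MulAut.conjNormal d : MulAut ↥(D.PiX ⊓ D.DeltaC)).toMonoidHom with hcd
    have hcd_apply : ∀ v : ↥(D.PiX ⊓ D.DeltaC), ((cd v : ↥(D.PiX ⊓ D.DeltaC)) : D.PiC) = d * v * d⁻¹ :=
      fun v => by change ((MulAut.conjNormal d v : ↥(D.PiX ⊓ D.DeltaC)) : D.PiC) = _; exact MulAut.conjNormal_apply d v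
    have hcdc : Continuous cd := by
      rw [hemb.isInducing.continuous_iff]
      have h2 : ((↑) : ↥(D.PiX ⊓ D.DeltaC) → D.PiC) ∘ cd = fun v : ↥(D.PiX ⊓ D.DeltaC) => d * (v : D.PiC) * d⁻¹ :=
        funext fun v => hcd_apply v
      rw [h2]
      exact (continuous_const.mul continuous_subtype_val).mul continuous_const
    set T : Subgroup ↥(D.PiX ⊓ D.DeltaC) := (φ.comp cd).eqLocus φ with hT
    have hTc : IsClosed ((T.map (D.PiX ⊓ D.DeltaC).subtype : Subgroup D.PiC) : Set D.PiC) := by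
      rw [Subgroup.coe_map, Subgroup.coe_subtype]
      refine hemb.isClosedMap _ ?_
      have hset : (T : Set ↥(D.PiX ⊓ D.DeltaC)) = {v | (φ.comp cd) v = φ v} := rfl
      rw [hset]
      exact isClosed_eq (hφc.comp hcdc) hφc
    have hle : (⁅D.PiX ⊓ D.DeltaC, D.PiX ⊓ D.DeltaC⁆).topologicalClosure ≤ T.map (D.PiX ⊓ D.DeltaC).subtype := by
      refine Subgroup.topologicalClosure_minimal _ ?_ hTc
      rw [Subgroup.commutator_le]
      intro p hp q hq
      obtain ⟨mp, hmp, hp'⟩ := hstar d hd p hp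
      obtain ⟨mq, hmq, hq'⟩ := hstar d hd q hq
      refine ⟨⟨p, hp⟩ * ⟨q, hq⟩ * ⟨p, hp⟩⁻¹ * ⟨q, hq⟩⁻¹, ?_, rfl⟩
      change (φ.comp cd) _ = φ _
      have hcp : cd ⟨p, hp⟩ = mp * ⟨p, hp⟩ := Subtype.ext (by rw [hcd_apply, Subgroup.coe_mul]; exact hp')
      have hcq : cd ⟨q, hq⟩ = mq * ⟨q, hq⟩ := Subtype.ext (by rw [hcd_apply, Subgroup.coe_mul]; exact hq')
      simp only [MonoidHom.comp_apply, map_mul, map_inv, hcp, hcq]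
      exact commutator_central_mul hmp hmq _ _
    obtain ⟨v, hv, hvu⟩ := hle hu
    rw [Subgroup.coe_subtype] at hvu
    have hvu' : v = ⟨u, huΔ⟩ := Subtype.ext hvu
    subst hvu'
    have h := hv
    change (φ.comp cd) _ = φ _ at h
    rw [MonoidHom.comp_apply] at h
    have hcu : cd ⟨u, huΔ⟩ = ⟨d * u * d⁻¹, hconj_mem d hd u huΔ⟩ := Subtype.ext (hcd_apply _)
    rw [hcu] at h
    exact h
  -- the cusp `x`: `I_x = ⟨w⟩⁻`, `w = k [a,b] k⁻¹`, `φ w = [x_K, y_K]` of order `l`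
  obtain ⟨k, hk, hIx⟩ := hcusp x
  set a : D.PiC := (gens 0 : D.PiC) with ha
  set b : D.PiC := (gens 1 : D.PiC) with hb
  set w : D.PiC := k * (a * b * a⁻¹ * b⁻¹) * k⁻¹ with hw
  have hcomm_mem : a * b * a⁻¹ * b⁻¹ ∈ ⁅D.PiX ⊓ D.DeltaC, D.PiX ⊓ D.DeltaC⁆ :=
    Subgroup.commutator_mem_commutator (gens 0).2 (gens 1).2
  have hwC : w ∈ ⁅D.PiX ⊓ D.DeltaC, D.PiX ⊓ D.DeltaC⁆ := (inferInstance : (⁅D.PiX ⊓ D.DeltaC, D.PiX ⊓ D.DeltaC⁆).Normal).conj_mem _ hcomm_mem k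
  have hwΔ : w ∈ D.PiX ⊓ D.DeltaC := Subgroup.commutator_le_left _ _ hwC
  have hIC : D.inertia x ≤ (⁅D.PiX ⊓ D.DeltaC, D.PiX ⊓ D.DeltaC⁆).topologicalClosure := by
    rw [hIx]
    exact Subgroup.topologicalClosure_mono (by rw [Subgroup.zpowers_le]; exact hwC)
  have hIΔ : D.inertia x ≤ D.PiX ⊓ D.DeltaC := fun v hv =>
    Subgroup.topologicalClosure_minimal _ (Subgroup.commutator_le_left _ _) hΔc (hIC hv)
  have hφw : φ ⟨w, hwΔ⟩ = xK * yK * xK⁻¹ * yK⁻¹ := by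
    have hwe : (⟨w, hwΔ⟩ : ↥(D.PiX ⊓ D.DeltaC)) = ⟨k, hk⟩ * (gens 0 * gens 1 * (gens 0)⁻¹ * (gens 1)⁻¹) * ⟨k, hk⟩⁻¹ :=
      Subtype.ext (by simp only [hw, ha, hb, Subgroup.coe_mul, Subgroup.coe_inv])
    rw [hwe, map_mul, map_mul, map_inv, map_mul, map_mul, map_mul, map_inv, map_inv, hφa, hφb]
    have hzc : xK * yK * xK⁻¹ * yK⁻¹ ∈ Subgroup.center K := hZc (hZcomm xK yK)
    rw [Subgroup.mem_center_iff.mp hzc (φ ⟨k, hk⟩), mul_inv_cancel_right]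
  have hordw : orderOf (φ ⟨w, hwΔ⟩) = D.l := by rw [hφw]; exact hord
  -- decompose `g = h d`, `d ∈ D_x`, `h ∈ Δ_X̲` (cusp rationality)
  obtain ⟨dd, hdd⟩ := hrat x (D.E.aug g)
  set d : D.PiC := (dd : D.PiC) with hddef
  have hdD : d ∈ D.decomp x := dd.2
  have hdX : d ∈ D.PiX := (D.decomp_le x hdD).1
  have haug : D.E.aug d = D.E.aug g := hdd
  set h : D.PiC := g * d⁻¹ with hhdef
  have hhΔC : h ∈ D.DeltaC := by
    change h ∈ D.E.geom
    rw [FundamentalExtension.mem_geom, hhdef, map_mul, map_inv, haug, mul_inv_cancel]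
  have hhXbar : h ∈ D.PiXbar := by
    have hdXbar : d ∈ D.PiXbar := D.decomp_le x hdD
    exact mul_mem hg (inv_mem hdXbar)
  have hhΔXbar : h ∈ D.DeltaXbar := ⟨hhXbar, hhΔC⟩
  -- `z′ = d z d⁻¹ ∈ I_x`
  set z' : D.PiC := d * z * d⁻¹ with hz'def
  have hzD : z ∈ D.decomp x := (Subgroup.mem_inf.mp hz).1
  have hzC : z ∈ D.DeltaC := (Subgroup.mem_inf.mp hz).2
  have hz'I : z' ∈ D.inertia x := by
    refine Subgroup.mem_inf.mpr ⟨mul_mem (mul_mem hdD hzD) (inv_mem hdD), ?_⟩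
    change d * z * d⁻¹ ∈ D.E.geom
    exact D.E.normal_geom.conj_mem z hzC d
  have hz'Xbar : z' ∈ D.DeltaXbar := D.inertia_le_deltaXbar x hz'I
  have hzXbar : z ∈ D.DeltaXbar := D.inertia_le_deltaXbar x hz
  -- the identity `g z g⁻¹ z⁻¹ = [h, z′] · (z′ z⁻¹)`
  have hid : g * z * g⁻¹ * z⁻¹ = (h * z' * h⁻¹ * z'⁻¹) * (z' * z⁻¹) := by
    rw [hhdef, hz'def]; group
  rw [hid]
  refine mul_mem ?_ ?_
  · -- `[h, z′] ∈ ⁅Δ_X̲, Δ_X̲⁆ ⊆ Ker`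
    show _ ∈ (⁅D.DeltaXbar, D.DeltaXbar⁆ ⊔
      Subgroup.closure ((fun y : D.PiC => y ^ D.l) '' (D.DeltaXbar : Set D.PiC))).topologicalClosure
    exact Subgroup.le_topologicalClosure _
      (Subgroup.mem_sup_left (Subgroup.commutator_mem_commutator hhΔXbar hz'Xbar))
  · -- `z′ z⁻¹ ∈ I_x ∩ Ker φ ⊆ ⟨w^l⟩⁻ ⊆ (Δ_X̲^l)⁻ ⊆ Ker`
    have hvI : z' * z⁻¹ ∈ D.inertia x := mul_mem hz'I (inv_mem hz)
    have hvΔ : z' * z⁻¹ ∈ D.PiX ⊓ D.DeltaC := hIΔ hvI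
    have hzΔ : z ∈ D.PiX ⊓ D.DeltaC := hIΔ hz
    have hφz' : φ ⟨z', hconj_mem d hdX z hzΔ⟩ = φ ⟨z, hzΔ⟩ := hfix d hdX z (hIC hz) hzΔ
    have hφv : φ ⟨z' * z⁻¹, hvΔ⟩ = 1 := by
      have he : (⟨z' * z⁻¹, hvΔ⟩ : ↥(D.PiX ⊓ D.DeltaC)) = ⟨z', hconj_mem d hdX z hzΔ⟩ * ⟨z, hzΔ⟩⁻¹ := Subtype.ext rfl
      rw [he, map_mul, map_inv, hφz', mul_inv_cancel]
    have hvw : z' * z⁻¹ ∈ (Subgroup.zpowers (w ^ D.l)).topologicalClosure :=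
      mem_closure_zpowers_pow_of_map_eq_one hΔc hφc hwΔ hl hordw (by rw [← hIx]; exact hvI) hvΔ hφv
    show _ ∈ (⁅D.DeltaXbar, D.DeltaXbar⁆ ⊔
      Subgroup.closure ((fun y : D.PiC => y ^ D.l) '' (D.DeltaXbar : Set D.PiC))).topologicalClosure
    refine Subgroup.topologicalClosure_minimal _ ?_ (Subgroup.isClosed_topologicalClosure _) hvw
    rw [Subgroup.zpowers_le]
    refine Subgroup.le_topologicalClosure _ (Subgroup.mem_sup_right (Subgroup.subset_closure ?_))
    have hwXbar : w ∈ D.DeltaXbar := D.inertia_le_deltaXbar x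
      (by rw [hIx]; exact Subgroup.le_topologicalClosure _ (Subgroup.mem_zpowers w))
    exact ⟨w, hwXbar, rfl⟩

/-- **(L4) from the origin record**: for `O : D.GeomOrigin` ((A)+(c′)) and cusp rationality (r), the field (∗)
yields `ModLCuspLaws.inertia_central`. ([IUTchI] §1 p.38) [claim: Mochizuki2012, status: disputed] -/
theorem GeomOrigin.inertia_central_of_rational (O : D.GeomOrigin)
    (hrat : ∀ x : D.Cusp, Function.Surjective (D.E.aug.toMonoidHom.comp (D.decomp x).subtype)) :
    ∀ x : D.Cusp, ∀ g ∈ D.PiXbar, ∀ z ∈ D.inertia x, g * z * g⁻¹ * z⁻¹ ∈ D.modLKer :=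
  D.inertia_central_of_star_freePro O.isFreeProOn O.inertia_eq_conj_commutator hrat

end PuncturedEllipticData

end Literature.IUT.HodgeTheaters

end
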